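import Mathlib
import Literature.Topology.FourManifolds.PlanarAchiralWords
import Literature.Topology.FourManifolds.PlanarShadowWalk
import Summits.SmoothPoincare4.SmoothPoincare4.Theorems.ConvexBisectionPlanarAcyclicBisectionRigidityStubK4Lift
import HarnessLib

/-!
# Stub `stub_k4LiftDouble` of line `Sketch` (k4-axis-calculus) for crux
# `ConvexBisection.PlanarAcyclicBisectionRigidity` (item stmt-SmoothPoincare4-15086)

**The lift of shadow walks to planar walks, DOUBLE form** (v1.6 re-cut of the landed
`stub_k4Lift`, `Theorems/ConvexBisectionPlanarAcyclicBisectionRigidityStubK4Lift.lean`: same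
hypothesis `InShadowNormalForm A B`, the shadow target restricted to `IsDoubleState t`, the planar
conclusion restricted to `TwistEq`).  From the shadow normal form `A = [d, g₁(c₀₁), h₁(c₁₂)]`,
`B = [d, g₂(c₀₁), h₂(c₁₂)]` one takes `w = x^{ḡ₁} y^{h̄₁}`, `P = (x^{ḡ₁}, y^{h̄₁})`,
`Q = (x^{ḡ₂}, y^{h̄₂}) ∈ XYPairs w`; the shadow walk from `startState P Q` lifts move by move to a
`PlanarWords` walk from `blockForm A B` (the landed `K4Lift.lift_walk`, invariant `K4Lift.Inv`:
four good letters, sign multiset `{+,+,−,−}`, the central letter `d` in front and `d̄` at the back);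
at a double state `[k₁, k₂, k₂⁻¹, k₁⁻¹]` the signs are read off the shadows (`K4Lift.sign_of_shadow`),
so the lifted state IS the block form `[d, c₀, c₁] · \overline{[d, c₃, c₂]}ʳᵉᵛ`, and `TwistEq 3`
holds letterwise because the positive twist of a good curve is `Φ` of its shadow
(`K4Lift.eval_twist_xy`).  Uses nothing unproved.
-/

noncomputable section

-- the prescribed namespace `Summit.<P>.<Sub>.…` duplicates `SmoothPoincare4` (P = Sub = SmoothPoincare4)
set_option linter.dupNamespace false

open Literature.Topology.FourManifolds Literature.Topology.FourManifolds.PlanarWords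
open Literature.Topology.FourManifolds.PlanarShadow (F₂ IsPos XYPairs startState IsBallState
  IsDoubleState InShadowNormalForm shadowWord shadowCurve shadowLetter IsXYGen IsCentralCurve)

namespace Summit.SmoothPoincare4.SmoothPoincare4.Theorems.PlanarAcyclicBisectionRigidity.Sketch

open K4Lift in
/-- **Stub `stub_k4LiftDouble` of line `Sketch` — THE LIFT, double form: shadow walks to doubles
are planar walks to honest doubles.**  From a word in shadow normal form
`A = [d, g₁(c₀₁), h₁(c₁₂)]`, `B = [d, g₂(c₀₁), h₂(c₁₂)]` one extracts `w = x^{ḡ₁} y^{h̄₁}` and the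
shadow pairs `P = (x^{ḡ₁}, y^{h̄₁})`, `Q = (x^{ḡ₂}, y^{h̄₂}) ∈ XYPairs w`; every double state
reachable from `startState P Q` is realised by a planar walk from `blockForm A B` (same `n = 3`)
to a block form `A′ · B̄′ʳᵉᵛ` with `TwistEq 3 A′ B′`. [folklore] -/
theorem stub_k4LiftDouble (A B : List PlanarCurve) (hnf : InShadowNormalForm A B) :
    ∃ (w : F₂) (P Q : F₂ × F₂),
      P ∈ XYPairs w ∧ Q ∈ XYPairs w ∧
      ∀ t : List F₂, Literature.Topology.FourManifolds.PlanarShadow.Reachable (startState P Q) t →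
        IsDoubleState t →
        ∃ (n' : ℕ) (A' B' : List PlanarCurve),
          Reachable (3, blockForm A B) (n', blockForm A' B') ∧ TwistEq n' A' B' := by
  obtain ⟨d, g₁, h₁, g₂, h₂, hd, hxy, rfl, rfl, heq⟩ := hnf
  simp only [List.append_assoc, List.mem_append] at hxy
  refine ⟨_, (shadowCurve ⟨0, 1, g₁⟩, shadowCurve ⟨1, 2, h₁⟩), (shadowCurve ⟨0, 1, g₂⟩, shadowCurve ⟨1, 2, h₂⟩),
    ⟨⟨shadowWord g₁, rfl⟩, ⟨shadowWord h₁, rfl⟩, rfl⟩, ⟨⟨shadowWord g₂, rfl⟩, ⟨shadowWord h₂, rfl⟩, heq.symm⟩,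
    fun t ht htarget => ?_⟩
  -- the start state satisfies the invariant; lift the shadow walk; the lifted state has 4 good letters
  obtain ⟨L, ⟨hgood, hperm, hreach⟩, hLt⟩ := lift_walk
    (S₀ := (3, blockForm [d, ⟨0, 1, g₁⟩, ⟨1, 2, h₁⟩] [d, ⟨0, 1, g₂⟩, ⟨1, 2, h₂⟩])) (d := d) ht
    ⟨[(⟨0, 1, g₁⟩, true), (⟨1, 2, h₁⟩, true), (⟨1, 2, h₂⟩, false), (⟨0, 1, g₂⟩, false)],
      ⟨by simpa [GoodC] using ⟨fun q h => hxy q (by tauto), fun q h => hxy q (by tauto),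
          fun q h => hxy q (by tauto), fun q h => hxy q (by tauto)⟩,
        List.Perm.refl _, Reachable.refl _⟩, rfl⟩
  have hl := hperm.length_eq
  rcases L with _ | ⟨⟨c₀, s₀⟩, _ | ⟨⟨c₁, s₁⟩, _ | ⟨⟨c₂, s₂⟩, _ | ⟨⟨c₃, s₃⟩, _ | _⟩⟩⟩⟩ <;> simp at hl
  obtain ⟨g0, g1, g2, g3⟩ : c₀ ∈ GoodC ∧ c₁ ∈ GoodC ∧ c₂ ∈ GoodC ∧ c₃ ∈ GoodC :=
    ⟨hgood (c₀, s₀) (by simp), hgood (c₁, s₁) (by simp), hgood (c₂, s₂) (by simp), hgood (c₃, s₃) (by simp)⟩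
  -- DOUBLE: the lifted state is a block form, `TwistEq` letterwise by the semantics of twists
  obtain ⟨k₁, k₂, hk₁, hk₂, rfl⟩ := htarget
  simp only [List.map_cons, List.map_nil, List.cons.injEq, and_true] at hLt
  obtain ⟨e0, e1, e2, e3⟩ := hLt
  obtain ⟨rfl, rfl⟩ : s₀ = true ∧ s₁ = true := ⟨(sign_of_shadow g0).1 (e0 ▸ hk₁), (sign_of_shadow g1).1 (e1 ▸ hk₂)⟩
  obtain ⟨rfl, rfl⟩ : s₂ = false ∧ s₃ = false := ⟨(sign_of_shadow g2).2 (by rw [e2, inv_inv]; exact hk₂),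
    (sign_of_shadow g3).2 (by rw [e3, inv_inv]; exact hk₁)⟩
  simp only [PlanarShadow.shadowLetter, if_true, Bool.false_eq_true, if_false, inv_inj] at e0 e1 e2 e3
  refine ⟨3, [d, c₀, c₁], [d, c₃, c₂], hreach, List.Forall₂.cons rfl (List.Forall₂.cons ?_
    (List.Forall₂.cons ?_ List.Forall₂.nil))⟩ <;> simp [eval_twist_xy, PlanarShadow.shadowLetter, *]

end Summit.SmoothPoincare4.SmoothPoincare4.Theorems.PlanarAcyclicBisectionRigidity.Sketch
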